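import Summits.RiemannHypothesis.RiemannHypothesis.Theorems.SuzukiStructureFunctionsEntire

/-!
# SuzukiStructureFunctionsExtendedSystem — the structure functions and the canonical system on `(−∞, 0]`:
# `A(t,z) = ½(E(z)e^{izt} + E(−z)e^{−izt})`, `B(t,z) = (i/2)(E(z)e^{izt} − E(−z)e^{−izt})`, and `∂_t A = zγB`,
# `∂_t B = −zγ⁻¹A` on `t < 0` — an inhabitant of `SolvesCanonicalSystemOn` (column DBR; RH-FREE)

LINE 1 — LABEL: RH-FREE (identities for ANY Suzuki pair; no zeros, no positivity); bears_on LADDER-RH B-D → B-P(P1): the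
negative-time half of «it solves the canonical system (2.11) on `(−∞,τ)` associated with the extended `H`» (Suzuki JFA21, display
after Thm. 3.1) is a THEOREM for the tree's (unextended) definitions, and it CALIBRATES the typed residual
`SuzukiStructure.Suzuki2021_thm31_dynamics` / `SolvesCanonicalSystemOn` (sign conventions `A_t = zγB`, `B_t = −zγ⁻¹A`).
WHAT THIS IS NOT: not progress toward RH; the canonical system on the CLEAN RANGE `(0,τ)` (Thm. 3.1 (4)) remains open.

Source: M. Suzuki, J. Funct. Anal. 281 (2021) 109116 = arXiv:1606.05726 [Suzuki2021Hamiltonians], §3.6 (display after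
Thm. 3.1), eq. (2.11), (3.33).

Contents (seat rh-dbr-eng-5 g7): `structA_of_nonpos`, `structB_of_nonpos` (closed forms for `t ≤ 0`),
`hasDerivAt_cexp_I_mul_ofReal`, `hasDerivAt_cexp_neg_I_mul_ofReal`, **`solvesCanonicalSystemOn_Iio`**.
-/

noncomputable section

-- D-0017: `Summit.<S>.<S>.…` is the designed namespace of a single-problem summit.
set_option linter.dupNamespace false

open MeasureTheory Set Filter Topology Function Complex

namespace Summit.RiemannHypothesis.RiemannHypothesis.Theorems.SuzukiStructureFunctions

open Literature.NumberTheory.LFunctions Literature.NumberTheory.LFunctions.SuzukiStructure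

variable {ϱ K : ℝ → ℝ} {t : ℝ}

/-! ## §21 The extended system on `(−∞, 0]`: `A(t,z) = ½(E(z)e^{izt} + E(−z)e^{−izt})`,
`B(t,z) = (i/2)(E(z)e^{izt} − E(−z)e^{−izt})` and the canonical system with `H = 1` on `t < 0`

Suzuki (after Thm. 3.1): «The Hamiltonian `H` is extended to `(−∞,τ)` by defining `m(t) = 1` for `t < 0`. Then, if we extend
the solution by `A(t,z) = ½(E(z)e^{itz} + E♯(z)e^{−itz}) = A(z)cos(tz) + B(z)sin(tz)`,
`B(t,z) = (i/2)(E(z)e^{itz} − E♯(z)e^{−itz})`, it solves the canonical system (2.11) on `(−∞,τ)` associated with the extended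
`H`.» With the tree's definitions nothing needs to be extended: for `t ≤ 0` the objects (3.26)–(3.39) ARE these functions
(§3–§4 of `…Basic`), and the canonical system `∂_t A = zγB`, `∂_t B = −zγ⁻¹A` (`γ = 1`) holds on `(−∞,0)` — an
inhabitant of the typed residual's predicate `SolvesCanonicalSystemOn`, fixing its sign conventions. -/

/-- RH-FREE. **For `t ≤ 0`: `A(t,z) = ½(E(z)e^{izt} + E(−z)e^{−izt})`** (`E = 𝖥ϱ`; `E♯ = E(−·)`; from
`E(t,z) = e^{izt}E(z)`, `A` even, `B` odd). -/
theorem structA_of_nonpos (h : IsSuzukiPair ϱ K) (ht : t ≤ 0) (z : ℂ) :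
    structA ϱ K t z = 1 / 2 * (cexp (I * z * t) * fourier ϱ z + cexp (-(I * z * t)) * fourier ϱ (-z)) := by
  have hsol1 := exists_isSuzukiPhiSolution_of_nonpos h.kernel_eq_zero 1 ht
  have hsolm := exists_isSuzukiPhiSolution_of_nonpos h.kernel_eq_zero (-1) ht
  have e1 := structE_of_nonpos h ht z
  have e2 := structE_of_nonpos h ht (-z)
  rw [structE_def] at e1 e2
  rw [structA_neg h hsol1, structB_neg h hsolm, show I * -z * (t : ℂ) = -(I * z * t) by ring] at e2
  linear_combination (1 / 2 : ℂ) * e1 + (1 / 2 : ℂ) * e2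

/-- RH-FREE. **For `t ≤ 0`: `B(t,z) = (i/2)(E(z)e^{izt} − E(−z)e^{−izt})`.** -/
theorem structB_of_nonpos (h : IsSuzukiPair ϱ K) (ht : t ≤ 0) (z : ℂ) :
    structB ϱ K t z = I / 2 * (cexp (I * z * t) * fourier ϱ z - cexp (-(I * z * t)) * fourier ϱ (-z)) := by
  have hsol1 := exists_isSuzukiPhiSolution_of_nonpos h.kernel_eq_zero 1 ht
  have hsolm := exists_isSuzukiPhiSolution_of_nonpos h.kernel_eq_zero (-1) ht
  have e1 := structE_of_nonpos h ht z
  have e2 := structE_of_nonpos h ht (-z)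
  rw [structE_def] at e1 e2
  rw [structA_neg h hsol1, structB_neg h hsolm, show I * -z * (t : ℂ) = -(I * z * t) by ring] at e2
  linear_combination (I / 2 : ℂ) * e1 + (-I / 2 : ℂ) * e2 + structB ϱ K t z * I_mul_I

/-- RH-FREE. `t ↦ e^{izt}` (real `t`) has derivative `iz·e^{izt}`. -/
theorem hasDerivAt_cexp_I_mul_ofReal (z : ℂ) (t : ℝ) :
    HasDerivAt (fun s : ℝ => cexp (I * z * s)) (I * z * cexp (I * z * t)) t := by
  have h1 : HasDerivAt (fun s : ℝ => I * z * (s : ℂ)) (I * z * 1) t :=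
    ((hasDerivAt_id t).ofReal_comp).const_mul (I * z)
  have h2 := h1.cexp
  convert h2 using 1
  ring

/-- RH-FREE. `t ↦ e^{−izt}` (real `t`) has derivative `−iz·e^{−izt}`. -/
theorem hasDerivAt_cexp_neg_I_mul_ofReal (z : ℂ) (t : ℝ) :
    HasDerivAt (fun s : ℝ => cexp (-(I * z * s))) (-(I * z) * cexp (-(I * z * t))) t := by
  have h := hasDerivAt_cexp_I_mul_ofReal (-z) t
  have e1 : (fun s : ℝ => cexp (I * -z * s)) = fun s : ℝ => cexp (-(I * z * s)) := by
    funext s; congr 1; ring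
  rw [e1] at h
  convert h using 1
  rw [show I * -z * (t : ℂ) = -(I * z * t) by ring]
  ring

/-- **RH-FREE · THE CANONICAL SYSTEM ON `(−∞, 0)`** (the extended system after Thm. 3.1, here a THEOREM about the
tree's unextended objects): for every Suzuki pair, `ᵗ(A(t,z), B(t,z))` solves `∂_t A = zγB`, `∂_t B = −zγ⁻¹A` at every
`t < 0` (`γ = 1` there) — an inhabitant of `SolvesCanonicalSystemOn`, fixing the sign conventions of the typed residual
`Suzuki2021_thm31_dynamics`. -/
theorem solvesCanonicalSystemOn_Iio (h : IsSuzukiPair ϱ K) :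
    SolvesCanonicalSystemOn (gamma K) (structA ϱ K) (structB ϱ K) (Iio 0) := by
  have hK3 : ∀ u : ℝ, u < 0 → K u = 0 := fun u hu => h.kernel_eq_zero u hu.le
  intro z t ht
  have ht' : t < 0 := ht
  have hγ : gamma K t = 1 := gamma_eq_one_of_nonpos hK3 ht'.le
  -- near `t < 0` the closed forms hold
  have hevA : (fun s : ℝ => structA ϱ K s z) =ᶠ[𝓝 t]
      fun s => 1 / 2 * (cexp (I * z * s) * fourier ϱ z + cexp (-(I * z * s)) * fourier ϱ (-z)) := by
    filter_upwards [Iio_mem_nhds ht'] with s hs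
    exact structA_of_nonpos h (le_of_lt hs) z
  have hevB : (fun s : ℝ => structB ϱ K s z) =ᶠ[𝓝 t]
      fun s => I / 2 * (cexp (I * z * s) * fourier ϱ z - cexp (-(I * z * s)) * fourier ϱ (-z)) := by
    filter_upwards [Iio_mem_nhds ht'] with s hs
    exact structB_of_nonpos h (le_of_lt hs) z
  have hdA : HasDerivAt (fun s : ℝ => 1 / 2 * (cexp (I * z * s) * fourier ϱ z + cexp (-(I * z * s)) * fourier ϱ (-z)))
      (1 / 2 * ((I * z * cexp (I * z * t)) * fourier ϱ z + (-(I * z) * cexp (-(I * z * t))) * fourier ϱ (-z))) t :=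
    (((hasDerivAt_cexp_I_mul_ofReal z t).mul_const _).add ((hasDerivAt_cexp_neg_I_mul_ofReal z t).mul_const _)).const_mul _
  have hdB : HasDerivAt (fun s : ℝ => I / 2 * (cexp (I * z * s) * fourier ϱ z - cexp (-(I * z * s)) * fourier ϱ (-z)))
      (I / 2 * ((I * z * cexp (I * z * t)) * fourier ϱ z - (-(I * z) * cexp (-(I * z * t))) * fourier ϱ (-z))) t :=
    (((hasDerivAt_cexp_I_mul_ofReal z t).mul_const _).sub ((hasDerivAt_cexp_neg_I_mul_ofReal z t).mul_const _)).const_mul _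
  refine ⟨(hdA.congr_of_eventuallyEq hevA).congr_deriv ?_, (hdB.congr_of_eventuallyEq hevB).congr_deriv ?_⟩
  · rw [structB_of_nonpos h ht'.le z, hγ]
    push_cast
    linear_combination (1 / 2 * z * (cexp (I * z * t) * fourier ϱ z - cexp (-(I * z * t)) * fourier ϱ (-z))) * I_mul_I
      - (1 / 2 * z * (cexp (I * z * t) * fourier ϱ z - cexp (-(I * z * t)) * fourier ϱ (-z))) * I_mul_I
  · rw [structA_of_nonpos h ht'.le z, hγ]
    push_cast
    linear_combination (1 / 2 * z * (cexp (I * z * t) * fourier ϱ z + cexp (-(I * z * t)) * fourier ϱ (-z))) * I_mul_I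

end Summit.RiemannHypothesis.RiemannHypothesis.Theorems.SuzukiStructureFunctions

end
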